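/-
Copyright: the b2b-balaban cell (near-miss cell 7), T⁴-continuum fan-out, lineage t4-ne7b-p2 (node U5c RENEWAL member).
Released under the licence of the surrounding project.
-/
import Literature.MathematicalPhysics.QuantumFieldTheory.Balaban1983to89.T4LiveStructureGas

/-!
# The renewal route's k-ary join: the catalogue over SETS of simultaneous partners exponentiates — no arity cap

Summits-side support leaf of the T⁴-continuum cell (rung (B)+1 on a FINITE torus only; NOT infinite volume, NOT the
mass gap, NOT the Clay statement; NOT a proof of the spine estimate NE7b).  Lineage `t4-ne7b-p2` (generation 22),
node U5c, RENEWAL route; the arithmetic behind the v1.5 remark of the ROUND-2 skeleton `t4/skeletons/NE7b-t4-ne7b-p2.md`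
(§2, «the ledger is arity-free»; journal NOTE 2026-08-20 l.5886, answering the row owner's finding F-ne7bp1g22-1 (b)):
on this road a join of `k ≥ 2` old structures at ONE step is ONE forest edge whose determined tail carries `k − 1` ledger
mergers (`T4PersistenceGrove.Script` allows any number of steps at the same absolute step), each absorbed partner `i`
paying its own normalised price `m i` (surplus × resummed partner mass × the bank's `1∕N`, `RenewalEdgeMass` ∕
`RenewalCatalogue`); the per-parent catalogue over the possible SETS of simultaneous partners is then the subset gas
`∏ (1 + m i) − 1 ≤ exp (Σ m i) − 1`, small when `Σ m i` is — NO bound on the arity `k` is needed.  [folklore] the subset-gas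
identity `T4LiveStructureGas.sum_powerset_famWeight_eq` (`Finset.prod_one_add`) BY NAME + `Real.add_one_le_exp`; nothing
printed is quoted or asserted; no `def … : Prop`, no `[cite:]`.

HONEST DEPENDENCY (cell): continuum YM on T⁴ ⇐ BetaPertH ∧ nine spine estimates (0/9 proved); BetaPertH ⇐ (D1) ∧ (D4)
∧ CAP+tail.  This file changes none of it.
-/

open Finset
open Literature.MathematicalPhysics.QuantumFieldTheory.Balaban1983to89
open T4LiveStructureGas

namespace Summit.QuantumFields.BalabanUV.T4Continuum.RenewalMultiJoin

noncomputable section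

section MultiJoin

variable {σ : Type*} [DecidableEq σ]

/-- **THE MULTI-JOIN CATALOGUE**: over the NONEMPTY sets `S` of simultaneous partners drawn from a finite pool `U` with
nonnegative normalised prices `m`, `Σ_{∅ ≠ S ⊆ U} ∏_{i ∈ S} m i = ∏_{i ∈ U} (1 + m i) − 1`. [folklore] -/
theorem sum_nonempty_famWeight_eq (U : Finset σ) (m : σ → ℝ) :
    ∑ S ∈ U.powerset with S.Nonempty, famWeight m S = ∏ i ∈ U, (1 + m i) - 1 := by
  have h := sum_powerset_famWeight_eq U m
  have hsplit : ∑ S ∈ U.powerset, famWeight m S =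
      ∑ S ∈ U.powerset with S.Nonempty, famWeight m S + ∑ S ∈ U.powerset with ¬ S.Nonempty, famWeight m S :=
    (Finset.sum_filter_add_sum_filter_not _ _ _).symm
  have hempty : ∑ S ∈ U.powerset with ¬ S.Nonempty, famWeight m S = 1 := by
    have hf : (U.powerset.filter fun S => ¬ S.Nonempty) = {∅} := by
      ext S
      simp only [Finset.mem_filter, Finset.mem_powerset, Finset.not_nonempty_iff_eq_empty, Finset.mem_singleton]
      exact ⟨fun h => h.2, fun h => ⟨h ▸ Finset.empty_subset _, h⟩⟩
    rw [hf, Finset.sum_singleton, famWeight_empty]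
  linarith

/-- **… AND IT EXPONENTIATES — NO ARITY CAP**: `Σ_{∅ ≠ S ⊆ U} ∏_{i ∈ S} m i ≤ exp (Σ_{i ∈ U} m i) − 1` for `m ≥ 0` on
`U`; in particular `≤ exp μ − 1` whenever the pool's total normalised price is `≤ μ`, however many partners join at once.
[folklore] -/
theorem sum_nonempty_famWeight_le_exp (U : Finset σ) {m : σ → ℝ} (hm : ∀ i ∈ U, 0 ≤ m i) :
    ∑ S ∈ U.powerset with S.Nonempty, famWeight m S ≤ Real.exp (∑ i ∈ U, m i) - 1 := by
  rw [sum_nonempty_famWeight_eq]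
  have h : ∏ i ∈ U, (1 + m i) ≤ ∏ i ∈ U, Real.exp (m i) :=
    Finset.prod_le_prod (fun i hi => by linarith [hm i hi]) fun i _ => by
      have := Real.add_one_le_exp (m i); linarith
  rw [← Real.exp_sum] at h
  linarith

/-- The same against a displayed total `Σ m ≤ μ`: `≤ exp μ − 1`. [folklore] -/
theorem sum_nonempty_famWeight_le_of_total (U : Finset σ) {m : σ → ℝ} (hm : ∀ i ∈ U, 0 ≤ m i) {μ : ℝ}
    (hμ : ∑ i ∈ U, m i ≤ μ) :
    ∑ S ∈ U.powerset with S.Nonempty, famWeight m S ≤ Real.exp μ - 1 :=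
  (sum_nonempty_famWeight_le_exp U hm).trans (by linarith [Real.exp_le_exp.2 hμ])

end MultiJoin

/-! ## A decided toy -/

section Toy

/-- three potential partners of normalised price `1∕10` each: the catalogue over the 7 nonempty partner sets is
`(11∕10)³ − 1 = 331∕1000 ≤ e^{3∕10} − 1` -/
example : ∑ S ∈ (Finset.univ : Finset (Fin 3)).powerset with S.Nonempty, famWeight (fun _ => (1 : ℝ) / 10) S ≤
    Real.exp (3 / 10) - 1 :=
  sum_nonempty_famWeight_le_of_total _ (fun _ _ => by norm_num) (by simp; norm_num)

/-- the number behind it: `(11/10)^3 − 1 = 331/1000` -/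
example : ((11 : ℚ) / 10) ^ 3 - 1 = 331 / 1000 := by norm_num

end Toy

end

end Summit.QuantumFields.BalabanUV.T4Continuum.RenewalMultiJoin
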